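import Summits.ABC.ABC.Theorems.IsogenyGlueCongruenceEllipticGluingPrimeBoundSlicesOfBound
import Literature.AlgebraicGeometry.Motives.AbelianVarietyEndGaloisDescent
import Literature.NumberTheory.GaloisRepresentations.AbsGaloisGroup
import HarnessLib

/-!
# Crux U `EllipticGluingPrimeBound` (stmt-ABC-13919), line `SketchIdeator5` — the `d = 1` shadow
# of the generic residual R_gen: fixed-curve torsion sharing for non-CM curves

Line `SketchIdeator5` reduces the crux U to two residual open statements; the generic one, R_gen
(`stub_genericPartnerBound`), says: for NON-CM `W/ℚ`, primes `ℓ ≥ 5` with surjective mod-`ℓ`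
Galois representation, and ℚ-simple partners `A` geometrically free of the model `E` of `W`, over
whose endomorphism field the congruence is FULL (every `g` in the commutator subgroup of
`Aut W[ℓ]` is `ρ̄_{W,ℓ}(σ)` for some `σ ∈ Γ_ℚ` fixing ALL geometric endomorphisms `r` of `A`), a
`Γ_ℚ`-equivariant embedding `W[ℓ] ↪ A(ℚ̄)` forces `ℓ ≤ C · ((dim A + 1) · max(1, h_F W))^κ`.

This file records the `d = 1` SHADOW of R_gen, its formal hardness certificate (provable now, by
specialisation): R_gen implies fixed-curve torsion sharing, uniform in the partner curve, for
non-CM `W` at primes `ℓ ≥ 5` of surjective `ρ̄_{W,ℓ}`, against partner curves `W'` whose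
abelian-variety model `A` has all its geometric endomorphisms `Γ_ℚ`-fixed.

* `fixedCurveSharing_of_genericPartnerBound` — **R_gen ⟹** there are absolute `κ ≥ 0`, `C` with
  `ℓ ≤ C · max(1, h_F(W))^κ` for every such `(W, W', ℓ)` carrying a `Γ_ℚ`-equivariant injection
  `W[ℓ] ↪ W'(ℚ̄)`.

Proof: for such partners the fullness hypothesis of R_gen is AUTOMATIC (surjectivity of
`ρ̄_{W,ℓ}` produces, for every `g ∈ Aut W[ℓ]`, a `σ` with `ρ̄_{W,ℓ}(σ) = g`, and `σ` fixes every
geometric endomorphism of `A` by hypothesis); `dim A = 1` (`dim_eq_one_of_equiv`), so `A` is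
ℚ-simple (`AbelianVariety.isSimple_of_dim_le_one`); transport the embedding along
`e'⁻¹ : W'(ℚ̄) ≃ A(ℚ̄)`; apply R_gen and absorb `(1 + 1)^κ = 2^κ` into the constant
(`C' = max C 0 · 2^κ`) — steps (2)–(4) verbatim as in
`fixedCurveTorsionSharing_of_ellipticGluingPrimeBound`
(`IsogenyGlueCongruenceEllipticGluingPrimeBoundFixedCurveSlice`). Unconditional; no new
definitions; no named facts; no `sorry`; lands `--supports stmt-ABC-13919`.
-/

noncomputable section

-- `Summit.<Summit>.<Problem>` is the mandated summit-side namespace (CONVENTIONS §2); for the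
-- single-conjunct summit `ABC` the two coincide, so the duplicate `ABC.ABC` is deliberate.
set_option linter.dupNamespace false

namespace Summit.ABC.ABC.Theorems.GluingSlices

open CategoryTheory CategoryTheory.Limits AlgebraicGeometry
open Literature.AlgebraicGeometry.Motives
open Summit.ABC.ABC.Theses.IsogenyGlueCongruence
open Summit.ABC.ABC.Theorems.IsotypicMinkowski

/-- **R_gen ⟹ fixed-curve torsion sharing for non-CM curves, uniform in the partner curve (the
`d = 1` shadow / hardness certificate of the generic residual R_gen of line `SketchIdeator5`).**
If R_gen (`stub_genericPartnerBound`) holds then there are absolute `κ ≥ 0`, `C` such that for all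
elliptic `W, W'/ℚ` with abelian-variety models `(E, e)`, `(A, e')` (equivariant identifications of
`ℚ̄`-points), `Hom(E_ℚ̄, A_ℚ̄) = 0`, all geometric endomorphisms of `A` fixed by `Γ_ℚ`, `W`
non-CM, and every prime `ℓ ≥ 5` with `ρ̄_{W,ℓ}` surjective admitting a `Γ_ℚ`-equivariant
injection `W[ℓ] ↪ W'(ℚ̄)`: `ℓ ≤ C · max(1, h_F(W))^κ`. The fullness hypothesis of R_gen is
automatic here (surjectivity plus the `Γ_ℚ`-fixedness of `End A_ℚ̄`), `dim A = 1` makes `A`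
ℚ-simple, and `(dim A + 1)^κ = 2^κ` is absorbed into the constant. -/
theorem fixedCurveSharing_of_genericPartnerBound :
    (∃ κ C : ℝ, 0 ≤ κ ∧ ∀ (W : WeierstrassCurve ℚ) [W.IsElliptic] (E A : AbelianVariety.{0} ℚ)
      (e : E.geomPoints ≃+ W.geomPoints),
      (∀ (σ : Field.absoluteGaloisGroup ℚ) (P : E.geomPoints), e (σ • P) = σ • e P) →
      (∀ f : E.baseChange (AlgebraicClosure ℚ) ⟶ A.baseChange (AlgebraicClosure ℚ), f = 0) →
      AbelianVariety.IsSimple A → ¬ W.HasCM →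
      ∀ ℓ : ℕ, ℓ.Prime → 5 ≤ ℓ → W.HasSurjectiveModNGaloisRep ℓ →
      (∀ g ∈ commutator (Multiplicative (AddAut (W.geomTorsion ℓ))),
        ∃ σ : Field.absoluteGaloisGroup ℚ,
          (∀ r : A.baseChange (AlgebraicClosure ℚ) ⟶ A.baseChange (AlgebraicClosure ℚ),
            A.galConj (AlgebraicClosure ℚ) (Field.absoluteGaloisGroup.toAlgEquiv ℚ σ) r = r) ∧
          W.galoisRepTorsion ℓ σ = g) →
      (∃ ι : W.geomTorsion ℓ →+ A.geomPoints, Function.Injective ι ∧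
        ∀ (σ : Field.absoluteGaloisGroup ℚ) (P : W.geomTorsion ℓ), ι (σ • P) = σ • ι P) →
        (ℓ : ℝ) ≤ C * (((A.dim : ℝ) + 1) * max 1 W.stableFaltingsHeight) ^ κ) →
    ∃ κ C : ℝ, 0 ≤ κ ∧ ∀ (W W' : WeierstrassCurve ℚ) [W.IsElliptic] [W'.IsElliptic]
      (E A : AbelianVariety.{0} ℚ) (e : E.geomPoints ≃+ W.geomPoints)
      (e' : A.geomPoints ≃+ W'.geomPoints),
      (∀ (σ : Field.absoluteGaloisGroup ℚ) (P : E.geomPoints), e (σ • P) = σ • e P) →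
      (∀ (σ : Field.absoluteGaloisGroup ℚ) (P : A.geomPoints), e' (σ • P) = σ • e' P) →
      (∀ f : E.baseChange (AlgebraicClosure ℚ) ⟶ A.baseChange (AlgebraicClosure ℚ), f = 0) →
      (∀ (σ : Field.absoluteGaloisGroup ℚ)
        (r : A.baseChange (AlgebraicClosure ℚ) ⟶ A.baseChange (AlgebraicClosure ℚ)),
        A.galConj (AlgebraicClosure ℚ) (Field.absoluteGaloisGroup.toAlgEquiv ℚ σ) r = r) →
      ¬ W.HasCM → ∀ ℓ : ℕ, ℓ.Prime → 5 ≤ ℓ → W.HasSurjectiveModNGaloisRep ℓ →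
      (∃ ι : W.geomTorsion ℓ →+ W'.geomPoints, Function.Injective ι ∧
        ∀ (σ : Field.absoluteGaloisGroup ℚ) (P : W.geomTorsion ℓ), ι (σ • P) = σ • ι P) →
        (ℓ : ℝ) ≤ C * (max 1 W.stableFaltingsHeight) ^ κ := by
  intro hR
  obtain ⟨κ, C, hκ, h⟩ := hR
  refine ⟨κ, max C 0 * (2 : ℝ) ^ κ, hκ, ?_⟩
  intro W W' _ _ E A e e' he he' hfree hfix hCM ℓ hℓ h5 hsurj hι
  obtain ⟨ι, hinj, hιeq⟩ := hι
  -- (1) the fullness hypothesis of R_gen is automatic: `ρ̄_{W,ℓ}` is surjective and every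
  -- `σ ∈ Γ_ℚ` fixes all geometric endomorphisms of `A`
  have hfull : ∀ g ∈ commutator (Multiplicative (AddAut (W.geomTorsion ℓ))),
      ∃ σ : Field.absoluteGaloisGroup ℚ,
        (∀ r : A.baseChange (AlgebraicClosure ℚ) ⟶ A.baseChange (AlgebraicClosure ℚ),
          A.galConj (AlgebraicClosure ℚ) (Field.absoluteGaloisGroup.toAlgEquiv ℚ σ) r = r) ∧
        W.galoisRepTorsion ℓ σ = g := by
    intro g _
    obtain ⟨σ, hσ⟩ := hsurj g
    exact ⟨σ, fun r ↦ hfix σ r, hσ⟩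
  -- (3) transport the embedding along `e'⁻¹ : W'(ℚ̄) ≃ A(ℚ̄)`
  have he'symm : ∀ (σ : Field.absoluteGaloisGroup ℚ) (Q : W'.geomPoints),
      e'.symm (σ • Q) = σ • e'.symm Q := by
    intro σ Q
    apply e'.injective
    rw [he', e'.apply_symm_apply, e'.apply_symm_apply]
  let ι' : W.geomTorsion ℓ →+ A.geomPoints := (e'.symm : W'.geomPoints →+ A.geomPoints).comp ι
  have hι' : ∃ ι' : W.geomTorsion ℓ →+ A.geomPoints, Function.Injective ι' ∧
      ∀ (σ : Field.absoluteGaloisGroup ℚ) (P : W.geomTorsion ℓ), ι' (σ • P) = σ • ι' P := by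
    refine ⟨ι', e'.symm.injective.comp hinj, fun σ P ↦ ?_⟩
    show e'.symm (ι (σ • P)) = σ • e'.symm (ι P)
    rw [hιeq, he'symm]
  -- (2) `dim A = 1`, so `A` is ℚ-simple
  have hA1 : A.dim = 1 := dim_eq_one_of_equiv e'
  have hsimple : AbelianVariety.IsSimple A := AbelianVariety.isSimple_of_dim_le_one hA1.le
  have hbound := h W E A e he hfree hsimple hCM ℓ hℓ h5 hsurj hfull hι'
  -- (4) absorb `(dim A + 1)^κ = 2^κ` into the constant
  set m : ℝ := max 1 W.stableFaltingsHeight with hm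
  have hm1 : (1 : ℝ) ≤ m := le_max_left _ _
  have hm0 : (0 : ℝ) ≤ m := zero_le_one.trans hm1
  have hdim : ((A.dim : ℝ) + 1) = 2 := by rw [hA1]; norm_num
  rw [hdim] at hbound
  have hsplit : ((2 : ℝ) * m) ^ κ = (2 : ℝ) ^ κ * m ^ κ := Real.mul_rpow (by norm_num) hm0
  calc (ℓ : ℝ) ≤ C * ((2 : ℝ) * m) ^ κ := hbound
    _ ≤ max C 0 * ((2 : ℝ) * m) ^ κ :=
        mul_le_mul_of_nonneg_right (le_max_left _ _) (Real.rpow_nonneg (by positivity) κ)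
    _ = max C 0 * (2 : ℝ) ^ κ * m ^ κ := by rw [hsplit, mul_assoc]

end Summit.ABC.ABC.Theorems.GluingSlices

end
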